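import Summits.CriticalPhenomena.SAWScalingLimit.Theorems.SAWDefectDecoherenceBoundaryClosureRInnerPolygonsHalfLattice
import Summits.CriticalPhenomena.SAWScalingLimit.Theorems.SAWDefectDecoherenceBoundaryClosureRRootWedgeChain
import HarnessLib

/-!
# Polygon limit data, II: escaping an exact polygon chart, and the depth of off-closure edges
(crux `BoundaryClosureR`, stmt-CriticalPhenomena-14004, line `polygon-parity-squeeze`, registered
stub `polygonLimitData` = piece C1 of the (A) assembly of `stub_polygonIdentification`)

The normalised bulk functional `N_δ(ψ)` of a test `ψ` supported off the root but CROSSING `∂Ω` sees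
mid-edges of `Λ_δ` whose scaled midpoints lie outside `closure Ω` (within `δ/2` of `Ω`).  Their mass
is not covered by the polygon `L¹` law (stated on compacts of `closure Ω`); it is controlled by the
boundary layer budgets once one knows that such edges hang at vertices of BOUNDED METRIC DEPTH.  This
file proves that depth bound from the local charts of an exact polygon family:

* `innerNormal_pair` — two of the six inner normals are either opposite or make an angle `≤ 120°`
  (`Re(n' conj n) ≥ -1/2`);
* `exists_escape` — in a chart ball `B(z, R)` where `Ω` is a zigzag half-plane, the intersection or
  the union of two of them, every point `m ∈ B(z, R) ∖ closure Ω` has an escape direction `u`,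
  `‖u‖ ≤ 1`: the disc of radius `s/4` about `m + s u` misses `Ω ∩ B(z, R)` for every `s > 0`;
* `depth_lt_of_offClosure` — hence, if the faces of `Λ` have their `δ`-scaled centres in `Ω`, a
  vertex `v ∈ Λ` carrying an edge whose scaled midpoint `m ∈ B(z, R - 16δ)` is off `closure Ω` has
  metric depth `< 16` (the escape disc of radius `3δ` at distance `12δ` contains a scaled face
  centre, `RootWedge.exists_site_near`, which is then a face outside `Λ` within `16` lattice units).
-/

noncomputable section

open scoped Topology ComplexConjugate
open Filter Set Metric
open Literature.Probability.LatticeModels Literature.Probability.RandomPlanarGeometry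
open Summit.CriticalPhenomena.SAWScalingLimit.Theorems.PickHalfPlane (RootWedge.exists_site_near)

namespace Summit.CriticalPhenomena.SAWScalingLimit.Theorems.PolygonParitySqueeze.PolygonLimitData

/-! ### 1. The six normals pairwise -/

/-- **Two inner normals are opposite or at angle `≤ 120°`.** For all `k, k'`, either
`n_{k'} = -n_k` or `Re(n_{k'} · conj n_k) ≥ -1/2` (the six normals are the sixth roots of `-1`).
[folklore] -/
theorem innerNormal_pair (k k' : Fin 6) :
    innerNormal k' = -innerNormal k ∨ -(1 / 2 : ℝ) ≤ (innerNormal k' * conj (innerNormal k)).re := by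
  have h3 : Real.sqrt 3 * Real.sqrt 3 = 3 := Real.mul_self_sqrt (by norm_num)
  have h3' : 0 < Real.sqrt 3 := Real.sqrt_pos.2 (by norm_num)
  have hs : Real.sqrt 3 / 2 ≠ -(Real.sqrt 3 / 2) := by intro h; linarith
  have hs' : -(Real.sqrt 3 / 2) ≠ Real.sqrt 3 / 2 := fun h => hs h.symm
  fin_cases k <;> fin_cases k' <;> simp [innerNormal_eq, Complex.ext_iff, hs, hs'] <;>
    try norm_num <;> nlinarith [h3, h3']

/-! ### 2. Levels -/

/-- Splitting a level at an intermediate point: `ℓ(y - z) = ℓ(y - m) + ℓ(m - z)`. [folklore] -/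
theorem level_split (n z m y : ℂ) :
    ((y - z) * conj n).re = ((y - m) * conj n).re + ((m - z) * conj n).re := by
  rw [← Complex.add_re, ← add_mul, sub_add_sub_cancel]

/-- Moving by `s·u` changes the level by `s·Re(u conj n)`. [folklore] -/
theorem level_add_smul (n z m u : ℂ) (s : ℝ) :
    ((m + (s : ℂ) * u - z) * conj n).re = ((m - z) * conj n).re + s * (u * conj n).re := by
  have e : m + (s : ℂ) * u - z = (m - z) + (s : ℂ) * u := by ring
  rw [e, add_mul, Complex.add_re, mul_assoc, Complex.re_ofReal_mul]

/-- **Escaping one half-plane.** If `m ∉ halfPlane k z`, the disc of radius `s/4` about `m - s n_k`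
misses `halfPlane k z`. [folklore] -/
theorem escape_one (k : Fin 6) (z m : ℂ) (hm : m ∉ halfPlane k z) {s : ℝ} (hs : 0 < s) {y : ℂ}
    (hy : dist y (m + (s : ℂ) * (-innerNormal k)) < s / 4) : y ∉ halfPlane k z := by
  rw [mem_halfPlane_iff_level, not_lt] at hm ⊢
  have h1 : ((m + (s : ℂ) * (-innerNormal k) - z) * conj (innerNormal k)).re =
      ((m - z) * conj (innerNormal k)).re - s := by
    rw [level_add_smul, neg_mul, Complex.neg_re, re_innerNormal_mul_conj]; ring
  have h2 := abs_level_le_dist k (m + (s : ℂ) * (-innerNormal k)) y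
  rw [level_split (innerNormal k) z (m + (s : ℂ) * (-innerNormal k)) y, h1]
  have h3 := (abs_le.1 (h2.trans hy.le)).2
  linarith

/-- **Escaping two half-planes at angle `≤ 120°`.** If `m` lies in neither of `halfPlane k z`,
`halfPlane k' z` and `Re(n_{k'} conj n_k) ≥ -1/2`, the disc of radius `s/4` about
`m - s (n_k + n_{k'})/2` misses both. [folklore] -/
theorem escape_two (k k' : Fin 6) (z m : ℂ) (hm : m ∉ halfPlane k z) (hm' : m ∉ halfPlane k' z)
    (hc : -(1 / 2 : ℝ) ≤ (innerNormal k' * conj (innerNormal k)).re) {s : ℝ} (hs : 0 < s) {y : ℂ}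
    (hy : dist y (m + (s : ℂ) * (-(innerNormal k + innerNormal k') / 2)) < s / 4) :
    y ∉ halfPlane k z ∧ y ∉ halfPlane k' z := by
  set n := innerNormal k with hn
  set n' := innerNormal k' with hn'
  set p := m + (s : ℂ) * (-(n + n') / 2) with hp
  have hc' : -(1 / 2 : ℝ) ≤ (n * conj n').re := by
    have e : (n * conj n').re = (n' * conj n).re := by
      rw [← Complex.conj_re (n * conj n'), map_mul, Complex.conj_conj, mul_comm]
    rw [e]; exact hc
  have hnn : (n * conj n).re = 1 := re_innerNormal_mul_conj k
  have hn'n' : (n' * conj n').re = 1 := re_innerNormal_mul_conj k'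
  rw [mem_halfPlane_iff_level, not_lt] at hm hm' ⊢
  rw [mem_halfPlane_iff_level, not_lt]
  -- the levels of `p`
  have hu : ∀ w : ℂ, ((-(n + n') / 2) * conj w).re = -(1 / 2) * ((n * conj w).re + (n' * conj w).re) := by
    intro w
    have e : (-(n + n') / 2) * conj w = (((-(1 / 2) : ℝ)) : ℂ) * (n * conj w + n' * conj w) := by
      push_cast; ring
    rw [e, Complex.re_ofReal_mul, Complex.add_re]
  have hp1 : ((p - z) * conj n).re ≤ -(s / 4) := by
    rw [hp, level_add_smul, hu n, hnn]; nlinarith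
  have hp2 : ((p - z) * conj n').re ≤ -(s / 4) := by
    rw [hp, level_add_smul, hu n', hn'n']; nlinarith
  have hd1 := (abs_le.1 ((abs_level_le_dist k p y).trans hy.le)).2
  have hd2 := (abs_le.1 ((abs_level_le_dist k' p y).trans hy.le)).2
  constructor
  · rw [level_split n z p y]; linarith
  · rw [level_split n' z p y]; linarith

/-- The escape vector of `escape_two` has norm `≤ 1`. [folklore] -/
theorem norm_escape_two_le (k k' : Fin 6) : ‖-(innerNormal k + innerNormal k') / 2‖ ≤ 1 := by
  rw [norm_div, norm_neg, Complex.norm_ofNat]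
  have := norm_add_le (innerNormal k) (innerNormal k')
  rw [norm_innerNormal, norm_innerNormal] at this
  linarith

/-! ### 3. Escaping a chart -/

/-- **Escape direction off the closure, in a polygon chart.** Let `Ω ∩ B(z, R)` be a zigzag
half-plane, the intersection, or the union of two zigzag half-planes through `z` (within the ball),
and let `m ∈ B(z, R)` lie off `closure Ω`.  Then there is `u`, `‖u‖ ≤ 1`, such that for every
`s > 0` the disc of radius `s/4` about `m + s u` contains no point of `Ω ∩ B(z, R)`.  (In the union
case the two normals are not opposite: otherwise `Ω ∩ B(z, R)` is the ball minus a line and `m` would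
lie in `closure Ω`.) [folklore] -/
theorem exists_escape {Ω : Set ℂ} {z : ℂ} {R : ℝ} {k k' : Fin 6}
    (hΩ : Ω ∩ ball z R = halfPlane k z ∩ ball z R ∨
      Ω ∩ ball z R = halfPlane k z ∩ halfPlane k' z ∩ ball z R ∨
      Ω ∩ ball z R = (halfPlane k z ∪ halfPlane k' z) ∩ ball z R)
    {m : ℂ} (hmR : m ∈ ball z R) (hm : m ∉ closure Ω) :
    ∃ u : ℂ, ‖u‖ ≤ 1 ∧ ∀ s : ℝ, 0 < s → ∀ y : ℂ, dist y (m + (s : ℂ) * u) < s / 4 →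
      y ∈ ball z R → y ∉ Ω := by
  have hmΩ : m ∉ Ω := fun h => hm (subset_closure h)
  rcases hΩ with h | h | h
  · -- one half-plane
    have hmk : m ∉ halfPlane k z := fun hk => hmΩ (by
      have : m ∈ Ω ∩ ball z R := by rw [h]; exact ⟨hk, hmR⟩
      exact this.1)
    refine ⟨-innerNormal k, by rw [norm_neg, norm_innerNormal], fun s hs y hy hyR hyΩ => ?_⟩
    have : y ∈ halfPlane k z ∩ ball z R := by rw [← h]; exact ⟨hyΩ, hyR⟩
    exact escape_one k z m hmk hs hy this.1
  · -- intersection of two half-planes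
    have hmkk : m ∉ halfPlane k z ∩ halfPlane k' z := fun hk => hmΩ (by
      have : m ∈ Ω ∩ ball z R := by rw [h]; exact ⟨hk, hmR⟩
      exact this.1)
    by_cases hmk : m ∈ halfPlane k z
    · have hmk' : m ∉ halfPlane k' z := fun hk' => hmkk ⟨hmk, hk'⟩
      refine ⟨-innerNormal k', by rw [norm_neg, norm_innerNormal], fun s hs y hy hyR hyΩ => ?_⟩
      have : y ∈ halfPlane k z ∩ halfPlane k' z ∩ ball z R := by rw [← h]; exact ⟨hyΩ, hyR⟩
      exact escape_one k' z m hmk' hs hy this.1.2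
    · refine ⟨-innerNormal k, by rw [norm_neg, norm_innerNormal], fun s hs y hy hyR hyΩ => ?_⟩
      have : y ∈ halfPlane k z ∩ halfPlane k' z ∩ ball z R := by rw [← h]; exact ⟨hyΩ, hyR⟩
      exact escape_one k z m hmk hs hy this.1.1
  · -- union of two half-planes
    have hmk : m ∉ halfPlane k z := fun hk => hmΩ (by
      have : m ∈ Ω ∩ ball z R := by rw [h]; exact ⟨Or.inl hk, hmR⟩
      exact this.1)
    have hmk' : m ∉ halfPlane k' z := fun hk => hmΩ (by
      have : m ∈ Ω ∩ ball z R := by rw [h]; exact ⟨Or.inr hk, hmR⟩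
      exact this.1)
    rcases innerNormal_pair k k' with hopp | hc
    · -- opposite normals: `m` would be in the closure
      exfalso
      apply hm
      have hl0 : ((m - z) * conj (innerNormal k)).re = 0 := by
        rw [mem_halfPlane_iff_level, not_lt] at hmk hmk'
        rw [hopp, map_neg, mul_neg, Complex.neg_re] at hmk'
        linarith
      -- the points `m + ε n_k`, `ε → 0⁺`
      set f : ℕ → ℂ := fun j => m + (((1 / ((j : ℝ) + 1) : ℝ)) : ℂ) * innerNormal k with hf
      have hft : Tendsto f atTop (𝓝 m) := by
        have h1 : Tendsto (fun j : ℕ => (((1 / ((j : ℝ) + 1) : ℝ)) : ℂ)) atTop (𝓝 0) := by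
          rw [← Complex.ofReal_zero]
          exact (Complex.continuous_ofReal.tendsto 0).comp tendsto_one_div_add_atTop_nhds_zero_nat
        have h2 := (h1.mul_const (innerNormal k)).const_add m
        rw [zero_mul, add_zero] at h2
        exact h2
      refine mem_closure_of_tendsto hft ?_
      filter_upwards [hft.eventually_mem (isOpen_ball.mem_nhds hmR)] with j hj
      have hpos : (0 : ℝ) < 1 / ((j : ℝ) + 1) := by positivity
      have hjk : f j ∈ halfPlane k z := by
        rw [mem_halfPlane_iff_level, hf, level_add_smul, hl0, re_innerNormal_mul_conj]; linarith
      have : f j ∈ Ω ∩ ball z R := by rw [h]; exact ⟨Or.inl hjk, hj⟩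
      exact this.1
    · refine ⟨-(innerNormal k + innerNormal k') / 2, norm_escape_two_le k k',
        fun s hs y hy hyR hyΩ => ?_⟩
      have hy' : y ∈ (halfPlane k z ∪ halfPlane k' z) ∩ ball z R := by rw [← h]; exact ⟨hyΩ, hyR⟩
      obtain ⟨h1, h2⟩ := escape_two k k' z m hmk hmk' hc hs hy
      rcases hy'.1 with h' | h'
      · exact h1 h'
      · exact h2 h'

/-! ### 4. The depth of a vertex carrying an off-closure edge -/

/-- `‖(1 + ζ)/3‖ ≤ 2/3` for the sixth root of unity `ζ = e^{iπ/3}`. [folklore] -/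
theorem norm_one_add_triZeta_div_three_le : ‖(1 + triZeta) / 3‖ ≤ 2 / 3 := by
  have hζ : ‖triZeta‖ = 1 := by
    rw [triZeta, show (Real.pi * Complex.I / 3 : ℂ) = ((Real.pi / 3 : ℝ) : ℂ) * Complex.I by
      push_cast; ring, Complex.norm_exp_ofReal_mul_I]
  rw [norm_div, Complex.norm_ofNat]
  have := norm_add_le (1 : ℂ) triZeta
  rw [norm_one, hζ] at this
  linarith

/-- **A scaled face centre in every disc of radius `3δ`.** [folklore] -/
theorem exists_face_near {δ : ℝ} (hδ : 0 < δ) (p : ℂ) :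
    ∃ y : HexVertex, dist ((δ : ℂ) * hexCenter y) p < 3 * δ := by
  obtain ⟨s, hs⟩ := RootWedge.exists_site_near hδ p
  refine ⟨(s, 0), ?_⟩
  have hc : hexCenter ((s, 0) : HexVertex) = triEmbed s + (1 + triZeta) / 3 := by
    simp only [hexCenter, Fin.val_zero, Nat.cast_zero, zero_add, one_mul]
  have h1 : ‖(δ : ℂ) * ((1 + triZeta) / 3)‖ ≤ δ * (2 / 3) := by
    rw [norm_mul, Complex.norm_real, Real.norm_of_nonneg hδ.le]
    exact mul_le_mul_of_nonneg_left norm_one_add_triZeta_div_three_le hδ.le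
  calc dist ((δ : ℂ) * hexCenter (s, 0)) p = ‖((δ : ℂ) * triEmbed s - p) + (δ : ℂ) * ((1 + triZeta) / 3)‖ := by
        rw [dist_eq_norm, hc]; congr 1; ring
    _ ≤ ‖(δ : ℂ) * triEmbed s - p‖ + ‖(δ : ℂ) * ((1 + triZeta) / 3)‖ := norm_add_le _ _
    _ ≤ 2 * δ + δ * (2 / 3) := add_le_add hs h1
    _ < 3 * δ := by linarith

/-- **Off-closure edges hang at vertices of depth `< 16`.** In a polygon chart `B(z, R)` of `Ω`,
let the faces of `Λ` have their `δ`-scaled centres in `Ω`, and let `v` be any face with a point `m`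
within `δ/2` of its scaled centre (e.g. the scaled midpoint of an edge at `v`) such that
`m ∈ B(z, R - 16δ) ∖ closure Ω`.  Then every metric depth of `v` in `Λ` is `< 16`: the escape disc
of radius `3δ` about `m + 12δ·u` contains a scaled face centre, inside the chart ball and off `Ω`,
hence a face outside `Λ` at lattice distance `< 16` from `v`. [folklore] -/
theorem depth_lt_of_offClosure {Ω : Set ℂ} {z : ℂ} {R : ℝ} {k k' : Fin 6}
    (hΩ : Ω ∩ ball z R = halfPlane k z ∩ ball z R ∨
      Ω ∩ ball z R = halfPlane k z ∩ halfPlane k' z ∩ ball z R ∨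
      Ω ∩ ball z R = (halfPlane k z ∪ halfPlane k' z) ∩ ball z R)
    {Λ : Finset HexVertex} {δ : ℝ} (hδ : 0 < δ) (hcar : ∀ y ∈ Λ, (δ : ℂ) * hexCenter y ∈ Ω)
    {v : HexVertex} {m : ℂ} (hvm : dist m ((δ : ℂ) * hexCenter v) ≤ δ / 2)
    (hmR : m ∈ ball z (R - 16 * δ)) (hm : m ∉ closure Ω) {j : ℕ} (hj : IsMetricDepth Λ v j) :
    j < 16 := by
  have hmR' : m ∈ ball z R := ball_subset_ball (by linarith) hmR
  obtain ⟨u, hu, hesc⟩ := exists_escape hΩ hmR' hm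
  set p : ℂ := m + (((12 * δ : ℝ)) : ℂ) * u with hp
  obtain ⟨y, hy⟩ := exists_face_near hδ p
  have hs : (0 : ℝ) < 12 * δ := by positivity
  -- the face `y` is in the chart ball and off `Ω`, hence outside `Λ`
  have hpm : dist p m ≤ 12 * δ := by
    rw [hp, dist_eq_norm, add_sub_cancel_left, norm_mul, Complex.norm_real, Real.norm_of_nonneg hs.le]
    exact (mul_le_mul_of_nonneg_left hu hs.le).trans (le_of_eq (mul_one _))
  have hyR : (δ : ℂ) * hexCenter y ∈ ball z R := by
    rw [mem_ball] at hmR ⊢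
    linarith [dist_triangle ((δ : ℂ) * hexCenter y) p z, dist_triangle p m z]
  have hyΩ : (δ : ℂ) * hexCenter y ∉ Ω := hesc (12 * δ) hs _ (by linarith) hyR
  have hyΛ : y ∉ Λ := fun h => hyΩ (hcar y h)
  -- but it is within lattice distance `16` of `v`
  have hdist : dist (hexCenter y) (hexCenter v) < 16 := by
    have h1 : dist ((δ : ℂ) * hexCenter y) ((δ : ℂ) * hexCenter v) < 16 * δ := by
      linarith [dist_triangle ((δ : ℂ) * hexCenter y) p ((δ : ℂ) * hexCenter v),
        dist_triangle p m ((δ : ℂ) * hexCenter v)]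
    have e : dist ((δ : ℂ) * hexCenter y) ((δ : ℂ) * hexCenter v) = δ * dist (hexCenter y) (hexCenter v) := by
      rw [dist_eq_norm, dist_eq_norm, ← mul_sub, norm_mul, Complex.norm_real, Real.norm_of_nonneg hδ.le]
    rw [e] at h1
    by_contra hge
    push Not at hge
    have := mul_le_mul_of_nonneg_left hge hδ.le
    linarith
  by_contra hj16
  push Not at hj16
  exact hyΛ (hj.1 y (hdist.le.trans (by exact_mod_cast hj16)))

/-! ### Registered form -/

/-- **Registered helper `polygonLimitData_depth`** (crux item stmt-CriticalPhenomena-14004, line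
`polygon-parity-squeeze`, sub-goal of the stub `polygonLimitData`): registry form (one `∀`-term) of
`depth_lt_of_offClosure`. [folklore] -/
theorem polygonLimitData_depth : ∀ (Ω : Set ℂ) (z : ℂ) (R : ℝ) (k k' : Fin 6), (Ω ∩ Metric.ball z R = halfPlane k z ∩ Metric.ball z R ∨ Ω ∩ Metric.ball z R = halfPlane k z ∩ halfPlane k' z ∩ Metric.ball z R ∨ Ω ∩ Metric.ball z R = (halfPlane k z ∪ halfPlane k' z) ∩ Metric.ball z R) → ∀ (Λ : Finset HexVertex) (δ : ℝ), 0 < δ → (∀ y ∈ Λ, (δ : ℂ) * hexCenter y ∈ Ω) → ∀ (v : HexVertex) (m : ℂ), dist m ((δ : ℂ) * hexCenter v) ≤ δ / 2 → m ∈ Metric.ball z (R - 16 * δ) → m ∉ closure Ω → ∀ j : ℕ, IsMetricDepth Λ v j → j < 16 :=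
  fun _ _ _ _ _ hΩ _ _ hδ hcar _ _ hvm hmR hm _ hj => depth_lt_of_offClosure hΩ hδ hcar hvm hmR hm hj

end Summit.CriticalPhenomena.SAWScalingLimit.Theorems.PolygonParitySqueeze.PolygonLimitData

end
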